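import Literature.NumberTheory.LFunctions.GranvilleSoundararajanTheorem4Window
import HarnessLib

/-!
# Granville–Soundararajan 2003, Theorem 4 (central form): the proof

DISCHARGE of the named fact
`Literature.NumberTheory.LFunctions.GranvilleSoundararajan.GranvilleSoundararajan2003_theorem4_central`
(A. Granville, K. Soundararajan, *Decay of mean values of multiplicative functions*, Canad. J. Math.
55 (2003), Theorem 4 — the twisted Lipschitz estimate — in the form established by its printed
proof, §6: maximisers `y₀` in the central half `|y₀| ≤ log x`, `x ≥ x₀`, `1 ≤ w ≤ √x`):
`|x⁻¹ ∑_{n≤x} f(n)n^{-iy₀} - (w/x) ∑_{n≤x/w} f(n)n^{-iy₀}|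
   ≪ (log 2w/log x)^{1-2/π} log(log x/log 2w) + (log log x)^{1+2(1-2/π)}/(log x)^{1-2/π}`.

The proof follows §6 of the paper (arXiv p. 9) for `f₀(n) = f(n) n^{-iy₀}`, `F₀(s) = F(s + iy₀)`:
(6.1) is the central-maximiser hypothesis; (6.2)–(6.5) and the `α`-integration are
`GranvilleSoundararajanTheorem4Window` (on top of `…Lemma21Lipschitz`, `…TwistedPlancherel`,
`…TwistedMeanSquare`, `…Lemma23`, `MertensFormula`); this file does the final bookkeeping:
* `theorem4_main_term_le`: with `M = max(log 2w, (log ℓ)²)`, `A = C₆ ℓ^{2/π} M^{1-2/π} + E`,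
  `(A/ℓ)(log(2ℓ/A) + 2) ≪ (log 2w/ℓ)^{1-2/π} log(ℓ/log 2w) + (log ℓ)^{1+2(1-2/π)}/ℓ^{1-2/π}`
  (cases `M = log 2w` and `M = (log ℓ)²`; `ℓ = log x`);
* `GranvilleSoundararajan2003_theorem4_central_holds`: builds `f₀` inline, feeds (6.4) into (6.3)
  into the reduction, and treats the degenerate case `A > 2ℓ` (which forces the right-hand side
  `≫ 1 ≥` left-hand side`/2`, or is impossible for `ℓ ≥ ℓ₀`); `x₀ = exp ℓ₀`.

## Main result
- `GranvilleSoundararajan2003_theorem4_central_holds : GranvilleSoundararajan2003_theorem4_central`.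

## References
- [GranvilleSoundararajan2003] A. Granville, K. Soundararajan, *Decay of mean values of
  multiplicative functions*, Canad. J. Math. 55 (2003), 1191–1230: Theorem 4 (arXiv p. 2) and §6
  (arXiv p. 9).
-/

noncomputable section

open Finset Real Complex MeasureTheory Set Filter

namespace Literature.NumberTheory.LFunctions

namespace GranvilleSoundararajan

open Halasz (S smoothCut mulLog mulVM smoothCut_of_mem smoothCut_of_not_mem norm_smoothCut_le)
open MellinPlancherel (psum)

/-! ### The final bookkeeping (§6, last paragraph) -/

/-- `log ℓ / ℓ ≤ 2 (log ℓ)^{1+2θ}/ℓ^θ` for `ℓ ≥ 3`, `0 ≤ θ ≤ 1`. [folklore] -/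
theorem log_div_le {ℓ θ : ℝ} (hℓ : 3 ≤ ℓ) (hθ0 : 0 ≤ θ) (hθ1 : θ ≤ 1) :
    Real.log ℓ / ℓ ≤ 2 * (Real.log ℓ ^ (1 + 2 * θ) / ℓ ^ θ) := by
  have hℓ0 : 0 < ℓ := by linarith
  have h := log_two_mul_div_le hℓ hθ0 hθ1
  have hmono : Real.log ℓ ≤ Real.log (2 * ℓ) := Real.log_le_log hℓ0 (by linarith)
  exact (div_le_div_of_nonneg_right hmono hℓ0.le).trans h

/-- **The main term of the `α`-integration against the printed right-hand side** (GS03 §6, "This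
gives the Theorem"): with `θ = 1 - 2/π`, `M = max(log 2w, (log ℓ)²)`, `A = C₆ ℓ^{2/π} M^θ + E`
(`C₆ > 0`, `E ≥ 1`, `ℓ ≥ 5`, `log 2 ≤ log 2w ≤ log 2 + ℓ/2`),
`(A/ℓ)(log(2ℓ/A) + 2) ≤ K₁ ((log 2w/ℓ)^θ log(ℓ/log 2w) + (log ℓ)^{1+2θ}/ℓ^θ)` for an explicit
`K₁ = K₁(C₆, E)`. [cite: GranvilleSoundararajan2003, §6 (last paragraph)] -/
theorem theorem4_main_term_le {C₆ E ℓ Lw θ M A : ℝ} (hC₆ : 0 < C₆) (hE : 1 ≤ E) (hℓ : 5 ≤ ℓ)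
    (hLw1 : Real.log 2 ≤ Lw) (hLw2 : Lw ≤ Real.log 2 + ℓ / 2) (hθ : θ = 1 - 2 / Real.pi)
    (hM : M = max Lw (Real.log ℓ ^ 2)) (hA : A = C₆ * ℓ ^ (2 / Real.pi) * M ^ θ + E) :
    A / ℓ * (Real.log (2 * ℓ / A) + 2) ≤
      (((max 0 (Real.log (2 / C₆)) + 2) / Real.log (3 / 2) + 1) * (C₆ + 4 * E) +
          (max 0 (Real.log (2 / C₆)) + 3) * (C₆ + 2 * E)) *
        ((Lw / ℓ) ^ θ * Real.log (ℓ / Lw) + Real.log ℓ ^ (1 + 2 * θ) / ℓ ^ θ) := by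
  -- basic facts
  have hπ3 : (3 : ℝ) < Real.pi := Real.pi_gt_three
  have hθ0 : 0 < θ := by rw [hθ, sub_pos, div_lt_one Real.pi_pos]; linarith
  have hθ1 : θ ≤ 1 := by
    have : (0 : ℝ) ≤ 2 / Real.pi := by positivity
    rw [hθ]; linarith
  have h2πθ : 2 / Real.pi + θ = 1 := by rw [hθ]; ring
  have hℓ0 : 0 < ℓ := by linarith
  have hℓ3 : 3 ≤ ℓ := by linarith
  have hlog2 : (0.6931471803 : ℝ) < Real.log 2 := Real.log_two_gt_d9
  have hlog2' : Real.log 2 < 0.6931471808 := Real.log_two_lt_d9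
  have hLw0 : 0 < Lw := by linarith
  have hlogℓ : 1 ≤ Real.log ℓ := by
    rw [Real.le_log_iff_exp_le hℓ0]
    have := Real.exp_one_lt_d9
    linarith
  have hM0 : 0 < M := by rw [hM]; exact lt_max_of_lt_left hLw0
  have hM1 : 1 ≤ M := by rw [hM]; exact le_max_of_le_right (one_le_pow₀ hlogℓ)
  have hLwM : Lw ≤ M := by rw [hM]; exact le_max_left _ _
  set c₁ : ℝ := Real.log (3 / 2) with hc₁
  have hc₁0 : 0 < c₁ := Real.log_pos (by norm_num)
  set c₂ : ℝ := max 0 (Real.log (2 / C₆)) with hc₂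
  have hc₂0 : 0 ≤ c₂ := le_max_left _ _
  set R₁ : ℝ := (Lw / ℓ) ^ θ * Real.log (ℓ / Lw) with hR₁
  set R₂ : ℝ := Real.log ℓ ^ (1 + 2 * θ) / ℓ ^ θ with hR₂
  have hℓLw : c₁ ≤ Real.log (ℓ / Lw) := by
    rw [hc₁]
    refine Real.log_le_log (by norm_num) ?_
    rw [le_div_iff₀ hLw0]; linarith
  have hlogℓLw0 : 0 ≤ Real.log (ℓ / Lw) := hc₁0.le.trans hℓLw
  have hR₁0 : 0 ≤ R₁ := mul_nonneg (Real.rpow_nonneg (by positivity) θ) hlogℓLw0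
  have hR₂0 : 0 < R₂ := by rw [hR₂]; positivity
  have hR₂' : Real.log ℓ / ℓ ≤ 2 * R₂ := log_div_le hℓ3 hθ0.le hθ1
  -- `A ≥ A₁ = C₆ ℓ^{2/π} M^θ > 0`
  set A₁ : ℝ := C₆ * ℓ ^ (2 / Real.pi) * M ^ θ with hA₁
  have hℓp : 0 < ℓ ^ (2 / Real.pi) := Real.rpow_pos_of_pos hℓ0 _
  have hMp : 0 < M ^ θ := Real.rpow_pos_of_pos hM0 _
  have hℓθ : 0 < ℓ ^ θ := Real.rpow_pos_of_pos hℓ0 _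
  have hA₁0 : 0 < A₁ := by positivity
  have hAA₁ : A₁ ≤ A := by rw [hA, hA₁]; linarith
  have hA0 : 0 < A := hA₁0.trans_le hAA₁
  -- (a) `A/ℓ = C₆ (M/ℓ)^θ + E/ℓ`
  have hℓsplit : ℓ ^ (2 / Real.pi) * ℓ ^ θ = ℓ := by
    rw [← Real.rpow_add hℓ0, h2πθ, Real.rpow_one]
  have hMℓ : (M / ℓ) ^ θ = M ^ θ / ℓ ^ θ := Real.div_rpow hM0.le hℓ0.le θ
  have ha : A / ℓ = C₆ * (M / ℓ) ^ θ + E / ℓ := by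
    rw [hMℓ, hA, add_div]
    congr 1
    calc C₆ * ℓ ^ (2 / Real.pi) * M ^ θ / ℓ
        = ℓ ^ (2 / Real.pi) * (C₆ * M ^ θ) / (ℓ ^ (2 / Real.pi) * ℓ ^ θ) := by rw [hℓsplit]; ring
      _ = C₆ * M ^ θ / ℓ ^ θ := by rw [mul_div_mul_left _ _ hℓp.ne']
      _ = C₆ * (M ^ θ / ℓ ^ θ) := by ring
  -- (b) `log(2ℓ/A) ≤ c₂ + θ log(ℓ/M)`
  have hb : Real.log (2 * ℓ / A) ≤ c₂ + θ * Real.log (ℓ / M) := by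
    have h1 : 2 * ℓ / A ≤ 2 * ℓ / A₁ := div_le_div_of_nonneg_left (by positivity) hA₁0 hAA₁
    have h2 : 2 * ℓ / A₁ = (2 / C₆) * (ℓ / M) ^ θ := by
      rw [Real.div_rpow hℓ0.le hM0.le, hA₁]
      calc 2 * ℓ / (C₆ * ℓ ^ (2 / Real.pi) * M ^ θ)
          = 2 * (ℓ ^ (2 / Real.pi) * ℓ ^ θ) / (ℓ ^ (2 / Real.pi) * (C₆ * M ^ θ)) := by rw [hℓsplit]; ring
        _ = ℓ ^ (2 / Real.pi) * (2 * ℓ ^ θ) / (ℓ ^ (2 / Real.pi) * (C₆ * M ^ θ)) := by ring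
        _ = 2 * ℓ ^ θ / (C₆ * M ^ θ) := by rw [mul_div_mul_left _ _ hℓp.ne']
        _ = (2 / C₆) * (ℓ ^ θ / M ^ θ) := by rw [div_mul_div_comm]
    calc Real.log (2 * ℓ / A) ≤ Real.log (2 * ℓ / A₁) := Real.log_le_log (by positivity) h1
      _ = Real.log (2 / C₆) + θ * Real.log (ℓ / M) := by
          rw [h2, Real.log_mul (by positivity) (Real.rpow_pos_of_pos (by positivity) θ).ne',
            Real.log_rpow (by positivity)]
      _ ≤ c₂ + θ * Real.log (ℓ / M) := by gcongr; exact le_max_right _ _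
  -- hence `(A/ℓ)(log(2ℓ/A)+2) ≤ (C₆ (M/ℓ)^θ + E/ℓ)(c₂ + 2 + θ log(ℓ/M))`
  have hP : A / ℓ * (Real.log (2 * ℓ / A) + 2) ≤ (C₆ * (M / ℓ) ^ θ + E / ℓ) * (c₂ + 2 + θ * Real.log (ℓ / M)) := by
    rw [ha]
    refine mul_le_mul_of_nonneg_left (by linarith) (by positivity)
  refine hP.trans ?_
  have hθlog : θ * Real.log (ℓ / M) ≤ Real.log ℓ := by
    have hlm : Real.log (ℓ / M) ≤ Real.log ℓ := by
      rw [Real.log_div hℓ0.ne' hM0.ne']; linarith [Real.log_nonneg hM1]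
    rcases le_or_gt 0 (Real.log (ℓ / M)) with h | h
    · calc θ * Real.log (ℓ / M) ≤ 1 * Real.log (ℓ / M) := mul_le_mul_of_nonneg_right hθ1 h
        _ ≤ Real.log ℓ := by rw [one_mul]; exact hlm
    · have : θ * Real.log (ℓ / M) < 0 := mul_neg_of_pos_of_neg hθ0 h
      linarith
  set K : ℝ := ((c₂ + 2) / c₁ + 1) * (C₆ + 4 * E) + (c₂ + 3) * (C₆ + 2 * E) with hK
  have hKa : ((c₂ + 2) / c₁ + 1) * (C₆ + 4 * E) ≤ K := by
    have : 0 ≤ (c₂ + 3) * (C₆ + 2 * E) := by positivity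
    rw [hK]; linarith
  have hKb : (c₂ + 3) * (C₆ + 2 * E) ≤ K := by
    have : 0 ≤ ((c₂ + 2) / c₁ + 1) * (C₆ + 4 * E) := by positivity
    rw [hK]; linarith
  rcases le_total (Real.log ℓ ^ 2) Lw with hcase | hcase
  · -- `M = Lw`
    have hMeq : M = Lw := by rw [hM, max_eq_left hcase]
    rw [hMeq]
    set k : ℝ := (c₂ + 2) / c₁ + 1 with hk
    have hk0 : 0 ≤ k := by positivity
    have hfac : c₂ + 2 + θ * Real.log (ℓ / Lw) ≤ k * Real.log (ℓ / Lw) := by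
      have h1 : c₂ + 2 ≤ (c₂ + 2) / c₁ * Real.log (ℓ / Lw) := by
        rw [div_mul_eq_mul_div, le_div_iff₀ hc₁0]
        exact mul_le_mul_of_nonneg_left hℓLw (by positivity)
      have h2 : θ * Real.log (ℓ / Lw) ≤ 1 * Real.log (ℓ / Lw) := mul_le_mul_of_nonneg_right hθ1 hlogℓLw0
      rw [hk]; linarith
    have hlogℓLw : Real.log (ℓ / Lw) ≤ 2 * Real.log ℓ := by
      rw [Real.log_div hℓ0.ne' hLw0.ne']
      have : -1 ≤ Real.log Lw := by
        have h1 : Real.log (Real.log 2) ≤ Real.log Lw := Real.log_le_log (by linarith) hLw1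
        have h2 : -1 ≤ Real.log (Real.log 2) := by
          rw [← Real.log_exp (-1)]
          refine Real.log_le_log (Real.exp_pos _) ?_
          rw [Real.exp_neg]
          have := Real.exp_one_gt_d9
          rw [inv_le_comm₀ (Real.exp_pos 1) (by linarith)]
          have h3 : (Real.log 2)⁻¹ ≤ 2 := by rw [inv_le_comm₀ (by linarith) (by norm_num)]; linarith
          linarith
        linarith
      linarith
    calc (C₆ * (Lw / ℓ) ^ θ + E / ℓ) * (c₂ + 2 + θ * Real.log (ℓ / Lw))
        ≤ (C₆ * (Lw / ℓ) ^ θ + E / ℓ) * (k * Real.log (ℓ / Lw)) :=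
          mul_le_mul_of_nonneg_left hfac (by positivity)
      _ = k * C₆ * R₁ + k * (E / ℓ * Real.log (ℓ / Lw)) := by rw [hR₁]; ring
      _ ≤ k * C₆ * R₁ + k * (E * (2 * (2 * R₂))) := by
          have hin : E / ℓ * Real.log (ℓ / Lw) ≤ E * (2 * (2 * R₂)) :=
            calc E / ℓ * Real.log (ℓ / Lw) ≤ E / ℓ * (2 * Real.log ℓ) := mul_le_mul_of_nonneg_left hlogℓLw (by positivity)
              _ = E * (2 * (Real.log ℓ / ℓ)) := by ring
              _ ≤ E * (2 * (2 * R₂)) :=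
                  mul_le_mul_of_nonneg_left (mul_le_mul_of_nonneg_left hR₂' (by norm_num)) (by linarith)
          exact add_le_add le_rfl (mul_le_mul_of_nonneg_left hin hk0)
      _ = k * (C₆ * R₁ + 4 * E * R₂) := by ring
      _ ≤ k * ((C₆ + 4 * E) * (R₁ + R₂)) := by
          refine mul_le_mul_of_nonneg_left ?_ hk0
          have e1 : 0 ≤ C₆ * R₂ := mul_nonneg hC₆.le hR₂0.le
          have e2 : 0 ≤ 4 * E * R₁ := mul_nonneg (by linarith) hR₁0
          have e3 : (C₆ + 4 * E) * (R₁ + R₂) = C₆ * R₁ + 4 * E * R₂ + (C₆ * R₂ + 4 * E * R₁) := by ring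
          linarith
      _ = (k * (C₆ + 4 * E)) * (R₁ + R₂) := by ring
      _ ≤ K * (R₁ + R₂) := mul_le_mul_of_nonneg_right hKa (by positivity)
  · -- `M = (log ℓ)²`
    have hMeq : M = Real.log ℓ ^ 2 := by rw [hM, max_eq_right hcase]
    have hlogℓ0 : 0 < Real.log ℓ := by linarith
    have hMθ : (M / ℓ) ^ θ = Real.log ℓ ^ (2 * θ) / ℓ ^ θ := by
      rw [Real.div_rpow hM0.le hℓ0.le, hMeq]
      congr 1
      rw [show (Real.log ℓ ^ 2 : ℝ) = Real.log ℓ ^ (2 : ℝ) by rw [← Real.rpow_natCast]; norm_num,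
        ← Real.rpow_mul hlogℓ0.le]
    have hfac : c₂ + 2 + θ * Real.log (ℓ / M) ≤ (c₂ + 3) * Real.log ℓ := by
      have e1 : (c₂ + 2) * 1 ≤ (c₂ + 2) * Real.log ℓ := mul_le_mul_of_nonneg_left hlogℓ (by positivity)
      have e2 : (c₂ + 3) * Real.log ℓ = (c₂ + 2) * Real.log ℓ + Real.log ℓ := by ring
      linarith
    have hpow : Real.log ℓ ^ (2 * θ) * Real.log ℓ = Real.log ℓ ^ (1 + 2 * θ) := by
      rw [show 1 + 2 * θ = 2 * θ + 1 by ring, Real.rpow_add_one hlogℓ0.ne']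
    calc (C₆ * (M / ℓ) ^ θ + E / ℓ) * (c₂ + 2 + θ * Real.log (ℓ / M))
        ≤ (C₆ * (M / ℓ) ^ θ + E / ℓ) * ((c₂ + 3) * Real.log ℓ) :=
          mul_le_mul_of_nonneg_left hfac (by positivity)
      _ = (c₂ + 3) * (C₆ * (Real.log ℓ ^ (2 * θ) * Real.log ℓ / ℓ ^ θ) + E * (Real.log ℓ / ℓ)) := by
          rw [hMθ]; ring
      _ = (c₂ + 3) * (C₆ * R₂ + E * (Real.log ℓ / ℓ)) := by rw [hpow]
      _ ≤ (c₂ + 3) * (C₆ * R₂ + E * (2 * R₂)) := by gcongr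
      _ = ((c₂ + 3) * (C₆ + 2 * E)) * R₂ := by ring
      _ ≤ K * R₂ := mul_le_mul_of_nonneg_right hKb hR₂0.le
      _ ≤ K * (R₁ + R₂) := by
          have hK0 : 0 ≤ K := le_trans (by positivity) hKb
          have : 0 ≤ K * R₁ := mul_nonneg hK0 hR₁0
          have e : K * (R₁ + R₂) = K * R₁ + K * R₂ := by ring
          linarith

/-! ### Theorem 4 (central form) -/

set_option maxHeartbeats 800000 in
/-- **Granville–Soundararajan 2003, Theorem 4** (the twisted Lipschitz estimate), in the form
established by its printed proof (§6: maximisers `y₀` in the central half `|y₀| ≤ log x`, `x ≥ x₀`,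
`1 ≤ w ≤ √x`), PROVED: there are absolute `C, x₀` with
`|x⁻¹ ∑_{n≤x} f(n)n^{-iy₀} - (w/x) ∑_{n≤x/w} f(n)n^{-iy₀}|
   ≤ C ((log 2w/log x)^{1-2/π} log(log x/log 2w) + (log log x)^{1+2(1-2/π)}/(log x)^{1-2/π})`.
Proof: §6 of the paper — (6.1) from the central-maximiser hypothesis, Proposition 3.3
(`GranvilleSoundararajanLemma21Lipschitz`, `GranvilleSoundararajanTwistedMeanSquare`) applied to
`f₀(n) = f(n) n^{-iy₀}` with `T = (log x)/2`, (6.3) from (2.6)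
(`GranvilleSoundararajanTwistedPlancherel`), (6.4) from Lemma 2.3 (tree) and Mertens, (6.5), and the
`α`-integration split at `α = 1/A`, `A ≍ (log x)^{2/π} max(log 2w, (log log x)²)^{1-2/π}`.
[cite: GranvilleSoundararajan2003, Theorem 4 and §6] -/
theorem GranvilleSoundararajan2003_theorem4_central_holds : GranvilleSoundararajan2003_theorem4_central := by
  obtain ⟨C₆, hC₆, h64⟩ := exists_norm_F_twist_le
  obtain ⟨CL, hCL0, hred⟩ := exists_norm_S_sub_le_of_window
  set θ : ℝ := 1 - 2 / Real.pi with hθ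
  have hπ3 : (3 : ℝ) < Real.pi := Real.pi_gt_three
  have hθ0 : 0 < θ := by rw [hθ, sub_pos, div_lt_one Real.pi_pos]; linarith
  have hθ1 : θ ≤ 1 := by
    have : (0 : ℝ) ≤ 2 / Real.pi := by positivity
    rw [hθ]; linarith
  set E : ℝ := 8 * Real.exp 5 with hE
  have hE1 : 1 ≤ E := by
    rw [hE]; have := Real.add_one_le_exp (5:ℝ); linarith
  set c₁ : ℝ := Real.log (3 / 2) with hc₁
  have hc₁0 : 0 < c₁ := Real.log_pos (by norm_num)
  set K₁ : ℝ := ((max 0 (Real.log (2 / C₆)) + 2) / Real.log (3 / 2) + 1) * (C₆ + 4 * E) +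
      (max 0 (Real.log (2 / C₆)) + 3) * (C₆ + 2 * E) with hK₁
  have hK₁0 : 0 ≤ K₁ := by rw [hK₁]; positivity
  set q : ℝ := (1 / C₆) ^ (1 / θ) with hq
  have hq0 : 0 < q := Real.rpow_pos_of_pos (by positivity) _
  have hqθ : q ^ θ = 1 / C₆ := by
    rw [hq, ← Real.rpow_mul (by positivity), one_div_mul_cancel hθ0.ne', Real.rpow_one]
  set ℓκ : ℝ := (16 / q) ^ 2 with hℓκ
  set ℓ₀ : ℝ := max (max 5 E) ℓκ with hℓ₀
  set Cfin : ℝ := 2 * C₆ / c₁ + 102 * K₁ + 3 * CL + CL / c₁ with hCfin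
  refine ⟨Cfin, Real.exp ℓ₀, ?_⟩
  intro f hf hfb x hx y₀ hy₀ hmax w hw1 hwx
  set ℓ : ℝ := Real.log x with hℓ
  have hexp0 : 0 < Real.exp ℓ₀ := Real.exp_pos _
  have hx0 : 0 < x := hexp0.trans_le hx
  have hℓ₀ℓ : ℓ₀ ≤ ℓ := by
    rw [hℓ, Real.le_log_iff_exp_le hx0]; exact hx
  have hℓ5 : 5 ≤ ℓ := le_trans (le_trans (le_max_left _ _) (le_max_left _ _)) hℓ₀ℓ
  have hℓE : E ≤ ℓ := le_trans (le_trans (le_max_right _ _) (le_max_left _ _)) hℓ₀ℓ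
  have hℓκℓ : ℓκ ≤ ℓ := le_trans (le_max_right _ _) hℓ₀ℓ
  have hℓ0 : 0 < ℓ := by linarith
  have hℓ3 : 3 ≤ ℓ := by linarith
  have hx9 : 9 ≤ x := by
    have h5 : Real.exp 5 ≤ x := by
      calc Real.exp 5 ≤ Real.exp ℓ := Real.exp_le_exp.mpr hℓ5
        _ = x := by rw [hℓ, Real.exp_log hx0]
    have : (9 : ℝ) ≤ Real.exp 5 := by
      have := Real.quadratic_le_exp_of_nonneg (show (0:ℝ) ≤ 5 by norm_num); linarith
    linarith
  have hx3 : 3 ≤ x := by linarith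
  have hw0 : 0 < w := by linarith
  have hsx : Real.sqrt x * Real.sqrt x = x := Real.mul_self_sqrt hx0.le
  have h1s : 1 ≤ Real.sqrt x := by rw [Real.le_sqrt (by norm_num) hx0.le]; linarith
  have hwx' : w ≤ x := by
    calc w ≤ Real.sqrt x := hwx
      _ = Real.sqrt x * 1 := (mul_one _).symm
      _ ≤ Real.sqrt x * Real.sqrt x := mul_le_mul_of_nonneg_left h1s (Real.sqrt_nonneg x)
      _ = x := hsx
  -- the twisted function `g(n) = f(n) n^{-iy₀}`
  set g : ArithmeticFunction ℂ := ⟨fun n => f n * (n : ℂ) ^ (-(y₀ * I)), by simp⟩ with hgdef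
  have hg0 : ∀ n, g n = f n * (n : ℂ) ^ (-(y₀ * I)) := fun n => rfl
  have hgm : g.IsMultiplicative := by
    refine ⟨by rw [hg0]; simp [hf.map_one], fun {m n} hmn => ?_⟩
    rw [hg0, hg0, hg0, hf.map_mul_of_coprime hmn, Nat.cast_mul, Complex.natCast_mul_natCast_cpow]
    ring
  have hgb : ∀ n, ‖g n‖ ≤ 1 := norm_twist_fun_le hg0 hfb
  -- the left-hand side is `‖S g x - w S g (x/w)‖ / x ≤ 2`
  have hS1 : (∑ n ∈ Icc 1 ⌊x⌋₊, f n * (n : ℂ) ^ (-(y₀ * I))) = S (⇑g) x := by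
    unfold S; exact Finset.sum_congr rfl (fun n _ => (hg0 n).symm)
  have hS2 : (∑ n ∈ Icc 1 ⌊x / w⌋₊, f n * (n : ℂ) ^ (-(y₀ * I))) = S (⇑g) (x / w) := by
    unfold S; exact Finset.sum_congr rfl (fun n _ => (hg0 n).symm)
  rw [hS1, hS2]
  have hLHS : ‖(x : ℂ)⁻¹ * S (⇑g) x - ((w / x : ℝ) : ℂ) * S (⇑g) (x / w)‖ =
      ‖S (⇑g) x - (w : ℂ) * S (⇑g) (x / w)‖ / x := by
    have hx0' : (x : ℂ) ≠ 0 := by exact_mod_cast hx0.ne'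
    have : (x : ℂ)⁻¹ * S (⇑g) x - ((w / x : ℝ) : ℂ) * S (⇑g) (x / w) =
        (x : ℂ)⁻¹ * (S (⇑g) x - (w : ℂ) * S (⇑g) (x / w)) := by
      push_cast; field_simp
    rw [this, norm_mul, norm_inv, Complex.norm_real, Real.norm_of_nonneg hx0.le, inv_mul_eq_div]
  rw [hLHS]
  have hLHS2 : ‖S (⇑g) x - (w : ℂ) * S (⇑g) (x / w)‖ / x ≤ 2 := by
    rw [div_le_iff₀ hx0]
    have h1 : ‖S (⇑g) x‖ ≤ x := Halasz.norm_S_le' hgb hx0.le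
    have h2 : ‖(w : ℂ) * S (⇑g) (x / w)‖ ≤ x := by
      rw [norm_mul, Complex.norm_real, Real.norm_of_nonneg hw0.le]
      calc w * ‖S (⇑g) (x / w)‖ ≤ w * (x / w) := mul_le_mul_of_nonneg_left (Halasz.norm_S_le' hgb (by positivity)) hw0.le
        _ = x := by field_simp
    calc ‖S (⇑g) x - (w : ℂ) * S (⇑g) (x / w)‖ ≤ ‖S (⇑g) x‖ + ‖(w : ℂ) * S (⇑g) (x / w)‖ := norm_sub_le _ _
      _ ≤ x + x := add_le_add h1 h2
      _ = 2 * x := by ring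
  -- the right-hand side pieces
  set Lw : ℝ := Real.log (2 * w) with hLw
  set M : ℝ := max Lw (Real.log ℓ ^ 2) with hM
  set A₀ : ℝ := C₆ * ℓ ^ (2 / Real.pi) * M ^ θ with hA₀
  set A : ℝ := A₀ + E with hA
  set R₁ : ℝ := (Lw / ℓ) ^ θ * Real.log (ℓ / Lw) with hR₁
  set R₂ : ℝ := Real.log ℓ ^ (1 + 2 * θ) / ℓ ^ θ with hR₂
  have hlog2 : (0.6931471803 : ℝ) < Real.log 2 := Real.log_two_gt_d9
  have hlog2' : Real.log 2 < 0.6931471808 := Real.log_two_lt_d9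
  have hLw1 : Real.log 2 ≤ Lw := by rw [hLw]; exact Real.log_le_log (by norm_num) (by linarith)
  have hLw2 : Lw ≤ Real.log 2 + ℓ / 2 := by
    rw [hLw, Real.log_mul (by norm_num) hw0.ne']
    have : Real.log w ≤ Real.log (Real.sqrt x) := Real.log_le_log hw0 hwx
    rw [Real.log_sqrt hx0.le, ← hℓ] at this
    linarith
  have hLw0 : 0 < Lw := by linarith
  have hLwℓ : Lw / ℓ ≤ 1 := by rw [div_le_one hℓ0]; linarith
  have hLwℓ0 : 0 < Lw / ℓ := by positivity
  have hℓLw : c₁ ≤ Real.log (ℓ / Lw) := by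
    rw [hc₁]
    refine Real.log_le_log (by norm_num) ?_
    rw [le_div_iff₀ hLw0]; linarith
  have hlogℓLw0 : 0 ≤ Real.log (ℓ / Lw) := hc₁0.le.trans hℓLw
  have hpowθ : Lw / ℓ ≤ (Lw / ℓ) ^ θ := Real.self_le_rpow_of_le_one hLwℓ0.le hLwℓ hθ1
  have hpowθ0 : 0 ≤ (Lw / ℓ) ^ θ := Real.rpow_nonneg hLwℓ0.le θ
  have hR₁0 : 0 ≤ R₁ := mul_nonneg hpowθ0 hlogℓLw0
  have hR₂0 : 0 < R₂ := by
    have : 1 ≤ Real.log ℓ := by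
      rw [Real.le_log_iff_exp_le hℓ0]; exact le_trans (by have := Real.exp_one_lt_d9; linarith) hℓ3
    rw [hR₂]; positivity
  have hM0 : 0 < M := by rw [hM]; exact lt_max_of_lt_left hLw0
  have hA₀0 : 0 ≤ A₀ := by rw [hA₀]; positivity
  have hA1 : 1 ≤ A := by rw [hA]; linarith
  have hCfin : 2 * C₆ / c₁ + 102 * K₁ + 3 * CL + CL / c₁ = Cfin := rfl
  have hgoalRHS : Cfin * ((Real.log (2 * w) / Real.log x) ^ θ * Real.log (Real.log x / Real.log (2 * w)) +
      Real.log (Real.log x) ^ (1 + 2 * θ) / Real.log x ^ θ) = Cfin * (R₁ + R₂) := by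
    simp only [hR₁, hR₂, hLw, hℓ]
  rw [hgoalRHS]
  have hCfin0 : 0 ≤ Cfin := by rw [← hCfin]; positivity
  -- (6.4): the window bound on `Re s = 1`
  have hA₀win : ∀ u : ℝ, |u| ≤ ℓ →
      ‖truncEulerProduct (⇑f) x (1 + (y₀ + u) * I)‖ * ‖1 - (w : ℂ) ^ (-((u : ℂ) * I))‖ ≤ A₀ := by
    intro u hu
    have h := h64 f hf hfb x hx3 y₀ (by simpa only [hℓ] using hy₀)
      (fun y hy => hmax y (by simpa only [hℓ] using hy)) w hw1 hwx' u (by simpa only [hℓ] using hu)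
    simpa only [hA₀, hM, hLw, hℓ, hθ] using h
  -- (6.3): the window bound on `Re s = 1 + α`
  have hwin : ∀ α : ℝ, 0 < α → α ≤ 1 → ∀ y : ℝ, |y| ≤ Real.log x / 2 →
      ‖LSeries (smoothCut (⇑g) ⌊x⌋₊) (1 + α + y * I) * (1 - (w : ℂ) ^ (1 - ((1 : ℂ) + α + y * I)))‖ ≤ A := by
    intro α hα hα1 y hy
    have h := norm_G_twist_window_le f hf hfb hg0 hx3 hw1 (A₀ := A₀) (fun u hu => hA₀win u (by rw [hℓ]; exact hu)) hα hy
    refine h.trans ?_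
    rw [hA, hE]
    have : 8 * Real.exp 5 * α ≤ 8 * Real.exp 5 * 1 := mul_le_mul_of_nonneg_left hα1 (by positivity)
    linarith
  by_cases hAℓ : A ≤ 2 * ℓ
  · -- the main case
    have hmain := hred g hgm hgb x hx9 w hw1 hwx A hA1 (by rw [← hℓ]; exact hAℓ) hwin
    rw [← hℓ, ← hLw] at hmain
    have hmt := theorem4_main_term_le (Lw := Lw) hC₆ hE1 hℓ5 hLw1 hLw2 hθ hM
      (by rw [hA, hA₀] : A = C₆ * ℓ ^ (2 / Real.pi) * M ^ θ + E)
    rw [← hK₁, ← hR₁, ← hR₂] at hmt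
    have h2 : Real.log (2 * ℓ) / ℓ ≤ 2 * R₂ := log_two_mul_div_le hℓ3 hθ0.le hθ1
    have h3 : Lw * Real.log (ℓ / Lw) / ℓ ≤ R₁ := by
      rw [hR₁, mul_div_right_comm]
      exact mul_le_mul_of_nonneg_right hpowθ hlogℓLw0
    have h4 : Lw / ℓ ≤ R₁ / c₁ := by
      rw [le_div_iff₀ hc₁0, hR₁]
      calc Lw / ℓ * c₁ ≤ (Lw / ℓ) ^ θ * c₁ := mul_le_mul_of_nonneg_right hpowθ hc₁0.le
        _ ≤ (Lw / ℓ) ^ θ * Real.log (ℓ / Lw) := mul_le_mul_of_nonneg_left hℓLw hpowθ0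
    -- divide the reduction by `ℓ`
    have hdiv : ‖S (⇑g) x - (w : ℂ) * S (⇑g) (x / w)‖ / x ≤
        102 * (A / ℓ * (Real.log (2 * ℓ / A) + 2)) +
          CL * (Real.log (2 * ℓ) / ℓ + Lw * Real.log (ℓ / Lw) / ℓ + Lw / ℓ) := by
      rw [← sub_nonneg] at hmain ⊢
      have heq : 102 * (A / ℓ * (Real.log (2 * ℓ / A) + 2)) +
            CL * (Real.log (2 * ℓ) / ℓ + Lw * Real.log (ℓ / Lw) / ℓ + Lw / ℓ) -
            ‖S (⇑g) x - (w : ℂ) * S (⇑g) (x / w)‖ / x =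
          (102 * A * Real.log (2 * ℓ / A) + 204 * A +
              CL * (Real.log (2 * ℓ) + Lw * Real.log (ℓ / Lw) + Lw) -
            ‖S (⇑g) x - (w : ℂ) * S (⇑g) (x / w)‖ / x * ℓ) / ℓ := by
        field_simp
        ring
      rw [heq]
      exact div_nonneg hmain hℓ0.le
    calc ‖S (⇑g) x - (w : ℂ) * S (⇑g) (x / w)‖ / x
        ≤ 102 * (A / ℓ * (Real.log (2 * ℓ / A) + 2)) +
            CL * (Real.log (2 * ℓ) / ℓ + Lw * Real.log (ℓ / Lw) / ℓ + Lw / ℓ) := hdiv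
      _ ≤ 102 * (K₁ * (R₁ + R₂)) + CL * (2 * R₂ + R₁ + R₁ / c₁) := by
          gcongr
      _ = (102 * K₁ + 3 * CL + CL / c₁) * (R₁ + R₂) - (2 * CL * R₁ + CL * R₂ + CL / c₁ * R₂) := by ring
      _ ≤ (102 * K₁ + 3 * CL + CL / c₁) * (R₁ + R₂) := by
          have : 0 ≤ 2 * CL * R₁ + CL * R₂ + CL / c₁ * R₂ := by positivity
          linarith
      _ ≤ Cfin * (R₁ + R₂) := by
          rw [← hCfin]
          have e1 : 0 ≤ 2 * C₆ / c₁ * (R₁ + R₂) := by positivity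
          have e2 : (2 * C₆ / c₁ + 102 * K₁ + 3 * CL + CL / c₁) * (R₁ + R₂) =
              (102 * K₁ + 3 * CL + CL / c₁) * (R₁ + R₂) + 2 * C₆ / c₁ * (R₁ + R₂) := by ring
          linarith
  · -- the trivial case `A > 2ℓ`: then `(M/ℓ)^θ > 1/C₆`
    push Not at hAℓ
    have hℓsplit : ℓ ^ (2 / Real.pi) * ℓ ^ θ = ℓ := by
      rw [← Real.rpow_add hℓ0, show 2 / Real.pi + θ = 1 by rw [hθ]; ring, Real.rpow_one]
    have hℓp : 0 < ℓ ^ (2 / Real.pi) := Real.rpow_pos_of_pos hℓ0 _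
    have hℓθ : 0 < ℓ ^ θ := Real.rpow_pos_of_pos hℓ0 _
    have hgt : 1 / C₆ < (M / ℓ) ^ θ := by
      have h1 : ℓ < C₆ * ℓ ^ (2 / Real.pi) * M ^ θ := by rw [← hA₀]; linarith
      have h2 : ℓ ^ (2 / Real.pi) * ℓ ^ θ < ℓ ^ (2 / Real.pi) * (C₆ * M ^ θ) := by rw [hℓsplit]; linarith
      have h3 : ℓ ^ θ < C₆ * M ^ θ := lt_of_mul_lt_mul_left h2 hℓp.le
      rw [Real.div_rpow hM0.le hℓ0.le, lt_div_iff₀ hℓθ]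
      calc 1 / C₆ * ℓ ^ θ < 1 / C₆ * (C₆ * M ^ θ) := mul_lt_mul_of_pos_left h3 (by positivity)
        _ = M ^ θ := by field_simp
    rcases le_total (Real.log ℓ ^ 2) Lw with hcase | hcase
    · -- `M = Lw`: the right-hand side is `≥ c₁/C₆`
      have hMeq : M = Lw := by rw [hM, max_eq_left hcase]
      rw [hMeq] at hgt
      have hR₁ge : c₁ / C₆ ≤ R₁ := by
        rw [hR₁]
        calc c₁ / C₆ = 1 / C₆ * c₁ := by ring
          _ ≤ (Lw / ℓ) ^ θ * Real.log (ℓ / Lw) := mul_le_mul hgt.le hℓLw hc₁0.le hpowθ0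
      calc ‖S (⇑g) x - (w : ℂ) * S (⇑g) (x / w)‖ / x ≤ 2 := hLHS2
        _ = 2 * C₆ / c₁ * (c₁ / C₆) := by field_simp
        _ ≤ 2 * C₆ / c₁ * R₁ := mul_le_mul_of_nonneg_left hR₁ge (by positivity)
        _ ≤ Cfin * (R₁ + R₂) := by
            rw [← hCfin]
            have e1 : 0 ≤ (102 * K₁ + 3 * CL + CL / c₁) * (R₁ + R₂) := by positivity
            have e2 : 0 ≤ 2 * C₆ / c₁ * R₂ := by positivity
            have e3 : (2 * C₆ / c₁ + 102 * K₁ + 3 * CL + CL / c₁) * (R₁ + R₂) =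
                2 * C₆ / c₁ * R₁ + (2 * C₆ / c₁ * R₂ + (102 * K₁ + 3 * CL + CL / c₁) * (R₁ + R₂)) := by ring
            linarith
    · -- `M = (log ℓ)²`: impossible for `ℓ ≥ ℓκ`
      exfalso
      have hMeq : M = Real.log ℓ ^ 2 := by rw [hM, max_eq_right hcase]
      have hMle : M ≤ 16 * Real.sqrt ℓ := by
        rw [hMeq, Real.sqrt_eq_rpow]; exact log_sq_le_sqrt (by linarith)
      have hsq : 16 / q ≤ Real.sqrt ℓ := by
        rw [Real.le_sqrt (by positivity) hℓ0.le, ← hℓκ]; exact hℓκℓ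
      have hsℓ0 : 0 < Real.sqrt ℓ := Real.sqrt_pos.mpr hℓ0
      have hMℓq : M / ℓ ≤ q := by
        calc M / ℓ ≤ 16 * Real.sqrt ℓ / ℓ := div_le_div_of_nonneg_right hMle hℓ0.le
          _ = 16 / Real.sqrt ℓ := by
              rw [mul_div_assoc, Real.sqrt_div_self', ← div_eq_mul_one_div]
          _ ≤ 16 / (16 / q) := div_le_div_of_nonneg_left (by norm_num) (by positivity) hsq
          _ = q := by field_simp
      have hle : (M / ℓ) ^ θ ≤ 1 / C₆ := by
        calc (M / ℓ) ^ θ ≤ q ^ θ := Real.rpow_le_rpow (by positivity) hMℓq hθ0.le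
          _ = 1 / C₆ := hqθ
      linarith

end GranvilleSoundararajan

end Literature.NumberTheory.LFunctions
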